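/-
Copyright (c) 2026 the pub-hodgecm-mathlib formalisation cell (harness21).  Prover seat hodgecm-mathlib-LH4-p10 (g3): dealer LH4-plan (g12) WORD #6 (3) «OF-RECORD DISCHARGE at Ω := ΩR»
under the (R-22) «κS-RECUT» ORDER OF SHAPE (heir LEAD F0P3a-plan (g19) T18-53; REF5 (g22) R5-122 (2) ∕ R5-126 recipe).  2026-09-04.
-/
import Summits.HodgeConjecture.HodgeConjecture.Theorems.F0P3cDyRamKappaSignLawR2Bridge    -- ★ p857007 (this seat): the ∨-bridge `…_of_forall_eq_one_or_ampl_eq_zero`; brings ★ №1-R2 p856987, ★ №1-R, ★ №1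
import Summits.HodgeConjecture.HodgeConjecture.Theorems.F0P3cDyRamOmegaRDefs              -- DEFS LEAF «ΩR» (this seat): `omegaR`, `omegaR_apply_eq_glueSign`; brings ★ p856975 `glueSign`, `glueSignR`
import Summits.HodgeConjecture.HodgeConjecture.Theorems.F0P3cDyRamDiagonalGlueSignEval      -- ★ p856992 (LH4-p04 (g2)): `glueSign_eq_one_of_v_sub_one_le`, `ampl_eq_zero_of_nonpos`
import Literature.NumberTheory.LocalFields.WildQuadraticDatumTrace                        -- ★ (p854561 family): `eq_succ_of_odd` (`d` odd ⇒ `d = t + 1`), `v_varpi_pow`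
import HarnessLib

/-!
# F0 · P3c · line LH4 «(D-RAM) FOUR-FRAME» — unit U3 §K-R2 (R-22 «κS-RECUT»): THE OF-RECORD DISCHARGE «`ΩR = 1` OR THE AXIS IS NOT READ» ON THE COVERED SET, AND THE
# COVERED-SET BRIDGE OF RECORD `KappaSignLawAtR2 omegaR N₀ tauOfRecord ↔ KappaSignLawAtR N₀ tauOfRecord` under `d % 2 = 1 ∨ 2 * d ≤ t + 2`

Cell `pub/hodgecm-mathlib`, crux H413 = `stmt-HodgeConjecture-24833` (helper lane `--supports stmt-HodgeConjecture-24833 --as helper`), route HCCMUnconditional; THEOREMS ONLY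
(no definition, no instance, no notation, no `sorry`); nothing asserted about the κ-laws themselves (census-law Props — prover targets, never literature facts).

WHAT IS PROVED (REF5 (g22) R5-122 (2)(b) ∕ R5-126; LEAD T18-53 covered guard, NO `d = t`).  At a ramified quadratic datum `(σ, ϖ; d, t)`, for roots `a, b ∈ E¹` under the root guard
`|a − 1|, |b − 1| < |2|`, an element datum `(a², b²; n₁, n₂, n₃)` (any threshold), a slot `i` and the re-cut parity datum `2B = n_i − d + 2 − 2·shiftR d t`, ON THE COVERED SET
`d % 2 = 1 ∨ 2d ≤ t + 2`:  **`omegaR K σ ϖ d a b i = 1 ∨ (ampl q k B = 0 ∧ ampl q k (B + tauOfRecord d) = 0)`** (`omegaR_eq_one_or_ampl_eq_zero_of_covered`) — the `hΩ` input of ★ p857007.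
* §1 valuation toolkit at the square datum: discreteness `x < exp n ⇒ x ≤ exp (n − 1)`; the root guard as `|w − 1| ≤ |ϖ|^{t+1}` for `w ∈ {a, b, b∕a}`; the RELATIVE-DEPTH identities
  `|c_i − 1|·|ϖ|^t = |ϖ|^{n_i}` for the symmetric units `(c₀, c₁, c₂) = (b, a, b∕a)` against the depths `(n₁, n₂, n₃) = (ord(b² − 1), ord(a² − 1), ord(a² − b²))` (`a + 1`, `b + 1`, `a + b` all
  have valuation `|2|` under the root guard).
* §2 the discharge: branch `2d ≤ t + 2` ⇒ `|c_i − 1| ≤ |ϖ|^{t+1} ≤ |ϖ|^{2d−1}` ⇒ `Or.inl` by ★ `glueSign_eq_one_of_v_sub_one_le`; branch `d` odd: if `B ≤ 0`, `Or.inr` by ★ `ampl_eq_zero_of_nonpos`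
  twice (`tauOfRecord d = −1`); if `B ≥ 1`, ★ `eq_succ_of_odd` gives `t = d − 1`, `shiftR d t = d − 1`, so `n_i ≥ 3d − 2 = (2d − 1) + t` and the relative-depth identity gives
  `|c_i − 1| ≤ |ϖ|^{2d−1}` ⇒ `Or.inl`.
* §3 THE BRIDGES OF RECORD: `kappaSignLawAtR2_omegaR_iff_kappaSignLawAtR_of_covered (N₀) (hcov) : KappaSignLawAtR2 omegaR N₀ tauOfRecord σ ϖ d t ↔ KappaSignLawAtR N₀ tauOfRecord σ ϖ d t`
  and the fenced-conjunction twin `fourFrameLawsWildAtR2_omegaR_iff_fourFrameLawsWildAtR_of_covered` (any threshold schedule `N₀`, in particular `depthOfRecord`): on the rows of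
  record `(d, t) ∈ {(2,2), (3,2), (2,4), …}` the Ω-aware re-cut κ-sign law IS the law of record ★ №1-R, and the U4 ∕ tier-0 consumers of the sign conjunct keep today's currency.
HONEST LABEL: HC_CM is proved only modulo the 7 printed citations (2 remaining: hLiu418 = stmt-HodgeConjecture-24832, h413 = stmt-HodgeConjecture-24833) until rung 0 closes;
count-neutral.

## References
* [Serre1979] J.-P. Serre, *Local Fields*, GTM 67 (1979): Ch. III §6 Prop. 13 (the different of a ramified quadratic extension), Ch. V §3 Prop. 5, Cor. 3 (norm residue on deep units).
* [LanglandsShelstad1987] R. P. Langlands, D. Shelstad, *On the definition of transfer factors*, Math. Ann. 278 (1987), §1.3, §3.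
* [Rogawski1990] J. D. Rogawski, *Automorphic Representations of Unitary Groups in Three Variables*, Ann. of Math. Stud. 123 (1990): §4.9 Prop. 4.9.1 (a) p. 55, §4.10 p. 58.
-/

set_option autoImplicit false

noncomputable section

namespace Summit.HodgeConjecture.HodgeConjecture.Cruxes.H413.F0P3cDyRamKappaSignLawR2OfRecord

open WithZero
open scoped Valued WithZero Matrix MatrixGroups
open Literature.NumberTheory.Automorphic Literature.NumberTheory.Automorphic.HermitianLattice
  Literature.NumberTheory.Automorphic.UnitaryLatticeTree Literature.NumberTheory.Automorphic.UnitaryThreeFourFrame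
open Literature.NumberTheory.LocalFields.WildQuadraticDatum (eq_succ_of_odd v_varpi_pow)
open Summit.HodgeConjecture.HodgeConjecture.Cruxes.H413.F0P3cDyRamFourFrameLawDefs
open Summit.HodgeConjecture.HodgeConjecture.Cruxes.H413.F0P3cDyRamFourFrameLawDefsR
open Summit.HodgeConjecture.HodgeConjecture.Cruxes.H413.F0P3cDyRamFourFrameLawDefsR2
open Summit.HodgeConjecture.HodgeConjecture.Cruxes.H413.F0P3cDyRamKappaSignLawR2Bridge
open Summit.HodgeConjecture.HodgeConjecture.Cruxes.H413.F0P3cDyRamOmegaRDefs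
open Summit.HodgeConjecture.HodgeConjecture.Cruxes.H413.F0P3cDyRamDiagonalGlueSignDefs
open Summit.HodgeConjecture.HodgeConjecture.Cruxes.H413.F0P3cDyRamDiagonalGlueSignEval

variable {K : Type} [Field K] [Valued K ℤᵐ⁰]

/-! ## §1  Valuation toolkit at the square datum -/

/-- Discreteness of `ℤᵐ⁰`: `x < exp n ⇒ x ≤ exp (n − 1)`. [cite: Serre1979, Ch. I §6 Prop. 18] -/
theorem le_exp_sub_one_of_lt_exp {x : ℤᵐ⁰} {n : ℤ} (h : x < exp n) : x ≤ exp (n - 1) := by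
  rcases eq_or_ne x 0 with rfl | hx
  · exact zero_le
  · rw [← exp_log hx] at h ⊢
    rw [exp_lt_exp] at h
    rw [exp_le_exp]
    omega

/-- An element of `E¹` is a unit: `a·σa = 1 ⇒ |a| = 1`. [cite: Serre1979, Ch. V §3] -/
theorem v_eq_one_of_mul_map_eq_one {σ : K →+* K} (hvσ : ∀ x, Valued.v (σ x) = Valued.v x) {a : K} (ha : a * σ a = 1) : Valued.v a = 1 := by
  have h : Valued.v a * Valued.v a = 1 := by nth_rw 2 [← hvσ a]; rw [← map_mul, ha, map_one]
  rw [← pow_two] at h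
  exact ((pow_eq_one_iff).1 h).resolve_right two_ne_zero

/-- THE ROOT GUARD, DISCRETELY: `|w − 1| < |2| = |ϖ|^t ⇒ |w − 1| ≤ |ϖ|^{t+1}`. [cite: Serre1979, Ch. I §6 Prop. 18] -/
theorem v_sub_one_le_pow_succ_of_lt_two {σ : K →+* K} {ϖ : K} {d t : ℕ} (hD : IsRamifiedQuadraticDatum σ ϖ d t) {w : K}
    (hw : Valued.v (w - 1) < Valued.v (2 : K)) : Valued.v (w - 1) ≤ Valued.v ϖ ^ (t + 1) := by
  obtain ⟨-, -, hϖ, -, -, -, h2⟩ := hD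
  rw [h2, v_varpi_pow hϖ] at hw
  rw [v_varpi_pow hϖ]
  have := le_exp_sub_one_of_lt_exp hw
  push_cast
  rwa [show (-(t : ℤ) - 1) = -((t : ℤ) + 1) by ring] at this

/-- The root guard transfers to the quotient: `|b∕a − 1| ≤ |ϖ|^{t+1}` (`|a| = 1`, `b∕a − 1 = ((b − 1) − (a − 1))∕a`). [cite: Serre1979, Ch. V §3] -/
theorem v_div_sub_one_le_pow_succ {σ : K →+* K} {ϖ : K} {d t : ℕ} (hD : IsRamifiedQuadraticDatum σ ϖ d t) {a b : K} (ha : a * σ a = 1)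
    (hga : Valued.v (a - 1) < Valued.v (2 : K)) (hgb : Valued.v (b - 1) < Valued.v (2 : K)) : Valued.v (b / a - 1) ≤ Valued.v ϖ ^ (t + 1) := by
  have hva : Valued.v a = 1 := v_eq_one_of_mul_map_eq_one hD.2.1 ha
  have ha0 : a ≠ 0 := fun h => by rw [h, map_zero] at hva; exact zero_ne_one hva
  have e : b / a - 1 = ((b - 1) - (a - 1)) / a := by field_simp; ring
  rw [e, map_div₀, hva, div_one]
  exact (Valuation.map_sub _ _ _).trans (max_le (v_sub_one_le_pow_succ_of_lt_two hD hgb) (v_sub_one_le_pow_succ_of_lt_two hD hga))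

/-- `|w + 1| = |2|` for `w` with `|w − 1| < |2|` (`w + 1 = 2 + (w − 1)`). [cite: Serre1979, Ch. V §3] -/
theorem v_add_one_eq_v_two {w : K} (hw : Valued.v (w - 1) < Valued.v (2 : K)) : Valued.v (w + 1) = Valued.v (2 : K) := by
  rw [show w + 1 = 2 + (w - 1) by ring]
  exact Valuation.map_add_eq_of_lt_left _ hw

/-- `|a + b| = |2|` for `a, b` with `|a − 1|, |b − 1| < |2|` (`a + b = 2 + ((a − 1) + (b − 1))`). [cite: Serre1979, Ch. V §3] -/
theorem v_add_eq_v_two {a b : K} (hga : Valued.v (a - 1) < Valued.v (2 : K)) (hgb : Valued.v (b - 1) < Valued.v (2 : K)) :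
    Valued.v (a + b) = Valued.v (2 : K) := by
  rw [show a + b = 2 + ((a - 1) + (b - 1)) by ring]
  exact Valuation.map_add_eq_of_lt_left _ ((Valuation.map_add _ _ _).trans_lt (max_lt hga hgb))

/-- RELATIVE DEPTH, slot of `w ∈ {a, b}`: `|w·w − 1| = |w − 1|·|2|` under the root guard. [cite: Rogawski1990, §4.10 p. 58] -/
theorem v_mul_self_sub_one_eq {w : K} (hw : Valued.v (w - 1) < Valued.v (2 : K)) : Valued.v (w * w - 1) = Valued.v (w - 1) * Valued.v (2 : K) := by
  rw [show w * w - 1 = (w - 1) * (w + 1) by ring, map_mul, v_add_one_eq_v_two hw]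

/-- RELATIVE DEPTH, slot of `b∕a`: `|a·a − b·b| = |b∕a − 1|·|2|` under the root guard (`|a| = 1`). [cite: Rogawski1990, §4.10 p. 58] -/
theorem v_mul_self_sub_mul_self_eq {σ : K →+* K} (hvσ : ∀ x, Valued.v (σ x) = Valued.v x) {a b : K} (ha : a * σ a = 1)
    (hga : Valued.v (a - 1) < Valued.v (2 : K)) (hgb : Valued.v (b - 1) < Valued.v (2 : K)) :
    Valued.v (a * a - b * b) = Valued.v (b / a - 1) * Valued.v (2 : K) := by
  have hva : Valued.v a = 1 := v_eq_one_of_mul_map_eq_one hvσ ha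
  have ha0 : a ≠ 0 := fun h => by rw [h, map_zero] at hva; exact zero_ne_one hva
  have e1 : a * a - b * b = (a - b) * (a + b) := by ring
  have e2 : b / a - 1 = (b - a) / a := by field_simp
  rw [e1, map_mul, v_add_eq_v_two hga hgb, e2, map_div₀, hva, div_one, Valuation.map_sub_swap]

/-- FROM RELATIVE DEPTH TO THE GLUE LEVEL: if `|c − 1|·|ϖ|^t = |ϖ|^n` and `(2d − 1) + t ≤ n` then `|c − 1| ≤ |ϖ|^{2d−1}`. [cite: Serre1979, Ch. I §6 Prop. 18] -/
theorem v_sub_one_le_of_relDepth {ϖ : K} (hϖ : Valued.v ϖ = exp (-1 : ℤ)) {c : K} {t n d : ℕ}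
    (hrel : Valued.v (c - 1) * Valued.v ϖ ^ t = Valued.v ϖ ^ n) (hn : (2 * d - 1) + t ≤ n) : Valued.v (c - 1) ≤ Valued.v ϖ ^ (2 * d - 1) := by
  rw [v_varpi_pow hϖ, v_varpi_pow hϖ] at hrel
  rw [v_varpi_pow hϖ]
  have hkey : Valued.v (c - 1) = exp (-(n : ℤ) + t) := by
    have h1 : Valued.v (c - 1) * exp (-(t : ℤ)) * exp (t : ℤ) = exp (-(n : ℤ)) * exp (t : ℤ) := by rw [hrel]
    rwa [mul_assoc, ← exp_add, show (-(t : ℤ) + t) = 0 by ring, exp_zero, mul_one, ← exp_add] at h1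
  rw [hkey, exp_le_exp]
  omega

/-! ## §2  The discharge «`ΩR = 1` or the axis is not read» on the covered set -/

/-- The three slots of the square datum packaged uniformly: for each `i` there are `c = (![b, a, b∕a]) i` and `n = (![n₁, n₂, n₃]) i` with `omegaR … i = glueSign σ ϖ d c`, the root-guard
bound `|c − 1| ≤ |ϖ|^{t+1}` and the relative-depth identity `|c − 1|·|ϖ|^t = |ϖ|^n`. [cite: Rogawski1990, §4.10 p. 58] -/
theorem exists_slot_data {σ : K →+* K} {ϖ : K} {d t : ℕ} (hD : IsRamifiedQuadraticDatum σ ϖ d t) {a b : K} (ha : a * σ a = 1)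
    (hga : Valued.v (a - 1) < Valued.v (2 : K)) (hgb : Valued.v (b - 1) < Valued.v (2 : K))
    {N₀ n₁ n₂ n₃ : ℕ} (hE : IsElementDatum σ ϖ N₀ (a * a) (b * b) n₁ n₂ n₃) (i : Fin 3) :
    ∃ (c : K) (n : ℕ), omegaR K σ ϖ d a b i = glueSign σ ϖ d c ∧ ((![n₁, n₂, n₃] : Fin 3 → ℕ) i : ℤ) = n ∧
      Valued.v (c - 1) ≤ Valued.v ϖ ^ (t + 1) ∧ Valued.v (c - 1) * Valued.v ϖ ^ t = Valued.v ϖ ^ n := by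
  obtain ⟨-, -, -, -, -, h₁, h₂, h₃, -, -, -⟩ := hE
  have h2 : Valued.v (2 : K) = Valued.v ϖ ^ t := hD.2.2.2.2.2.2
  fin_cases i
  · refine ⟨b, n₁, rfl, rfl, v_sub_one_le_pow_succ_of_lt_two hD hgb, ?_⟩
    rw [← h2, ← v_mul_self_sub_one_eq hgb, h₁]
  · refine ⟨a, n₂, rfl, rfl, v_sub_one_le_pow_succ_of_lt_two hD hga, ?_⟩
    rw [← h2, ← v_mul_self_sub_one_eq hga, h₂]
  · refine ⟨b / a, n₃, rfl, rfl, v_div_sub_one_le_pow_succ hD ha hga hgb, ?_⟩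
    rw [← h2, ← v_mul_self_sub_mul_self_eq hD.2.1 ha hga hgb, h₃]

/-- **THE OF-RECORD DISCHARGE.**  On the covered set `d % 2 = 1 ∨ 2 * d ≤ t + 2`, for every admissible square datum (roots `a, b ∈ E¹` under the root guard, element datum
`(a², b²; n₁, n₂, n₃)` at any threshold, `2k + d = Σn + 2` not needed, slot `i`, parity datum `2B = n_i − d + 2 − 2·shiftR d t`):
`omegaR K σ ϖ d a b i = 1 ∨ (ampl q k B = 0 ∧ ampl q k (B + tauOfRecord d) = 0)`, `q = #𝓀[K]`.  Branch `2d ≤ t+2`: the root guard puts every symmetric unit within `|ϖ|^{2d−1}` of `1`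
(★ `glueSign_eq_one_of_v_sub_one_le`); branch `d` odd: an unread axis (`B ≤ 0`, ★ `ampl_eq_zero_of_nonpos`, `tauOfRecord d = −1`) or a deep one (`B ≥ 1` ⇒ `n_i ≥ 3d − 2` by
★ `eq_succ_of_odd`, then the relative-depth identity). [cite: Serre1979, Ch. III §6 Prop. 13; Ch. V §3 Prop. 5, Cor. 3] [cite: LanglandsShelstad1987, §3] -/
theorem omegaR_eq_one_or_ampl_eq_zero_of_covered [CompleteSpace K] [Fintype 𝓀[K]] {σ : K →+* K} {ϖ : K} {d t : ℕ} (hD : IsRamifiedQuadraticDatum σ ϖ d t)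
    (hcov : d % 2 = 1 ∨ 2 * d ≤ t + 2) {a b : K} (ha : a * σ a = 1) (hb : b * σ b = 1)
    (hga : Valued.v (a - 1) < Valued.v (2 : K)) (hgb : Valued.v (b - 1) < Valued.v (2 : K))
    {N₀ n₁ n₂ n₃ : ℕ} (hE : IsElementDatum σ ϖ N₀ (a * a) (b * b) n₁ n₂ n₃) (k : ℕ) (i : Fin 3) {B : ℤ}
    (hB : 2 * B = ((![n₁, n₂, n₃] : Fin 3 → ℕ) i : ℤ) - d + 2 - 2 * shiftR d t) :
    omegaR K σ ϖ d a b i = 1 ∨ (ampl (Fintype.card 𝓀[K]) k B = 0 ∧ ampl (Fintype.card 𝓀[K]) k (B + tauOfRecord d) = 0) := by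
  have _hb := hb
  obtain ⟨hσ, hvσ, hϖ, hfix, hdiff, hd1, h2⟩ := hD
  have hD' : IsRamifiedQuadraticDatum σ ϖ d t := ⟨hσ, hvσ, hϖ, hfix, hdiff, hd1, h2⟩
  obtain ⟨c, n, hci, hni, hct, hrel⟩ := exists_slot_data hD' ha hga hgb hE i
  have hϖ1 : Valued.v ϖ ≤ 1 := by rw [hϖ, ← exp_zero, exp_le_exp]; omega
  rcases hcov with hodd | hsmall
  · -- `d` odd: `d = t + 1`
    have hdt : d = t + 1 := eq_succ_of_odd hσ hfix hϖ hdiff h2 (Nat.odd_iff.2 hodd)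
    by_cases hB0 : B ≤ 0
    · right
      have hq : 1 ≤ Fintype.card 𝓀[K] := Fintype.card_pos_iff.2 ⟨0⟩
      have hτ : tauOfRecord d = -1 := by simp [tauOfRecord, hodd]
      exact ⟨ampl_eq_zero_of_nonpos hq k hB0, ampl_eq_zero_of_nonpos hq k (by rw [hτ]; omega)⟩
    · left
      have hs : shiftR d t = ((d - d % 2 : ℕ) : ℤ) := rfl
      rw [hni, hs, hodd] at hB
      have hn : (2 * d - 1) + t ≤ n := by omega
      rw [hci]
      exact glueSign_eq_one_of_v_sub_one_le hD' (v_sub_one_le_of_relDepth hϖ hrel hn)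
  · -- `2d ≤ t + 2`: the root guard suffices
    left
    rw [hci]
    refine glueSign_eq_one_of_v_sub_one_le hD' (hct.trans ?_)
    exact pow_le_pow_right_of_le_one' hϖ1 (by omega)

/-! ## §3  The covered-set bridges OF RECORD -/

/-- **THE COVERED-SET BRIDGE OF RECORD (κ-sign cut)**: on the covered set `d % 2 = 1 ∨ 2 * d ≤ t + 2`, for ANY threshold schedule `N₀` and the type shift of record,
`KappaSignLawAtR2 omegaR N₀ tauOfRecord σ ϖ d t ↔ KappaSignLawAtR N₀ tauOfRecord σ ϖ d t` — the Ω-aware re-cut κ-sign law IS ★ №1-R's law at every row of record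
(`(2,2)`, `(3,2)`, e2c `(2,4)`, …). (★ p857007 fed with §2.) [cite: LanglandsShelstad1987, §1.3] [cite: Rogawski1990, §4.9 Prop. 4.9.1 (a) p. 55] -/
theorem kappaSignLawAtR2_omegaR_iff_kappaSignLawAtR_of_covered [CompleteSpace K] [Fintype 𝓀[K]] (N₀ : ℕ → ℕ) (σ : K →+* K) (ϖ : K) {d t : ℕ}
    (hcov : d % 2 = 1 ∨ 2 * d ≤ t + 2) :
    KappaSignLawAtR2 omegaR N₀ tauOfRecord σ ϖ d t ↔ KappaSignLawAtR N₀ tauOfRecord σ ϖ d t :=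
  kappaSignLawAtR2_iff_kappaSignLawAtR_of_forall_eq_one_or_ampl_eq_zero omegaR N₀ tauOfRecord σ ϖ d t
    fun _ _ _ _ _ _ k i _ hD _ _ ha hb ha1 hb1 hE _ hB => omegaR_eq_one_or_ampl_eq_zero_of_covered hD hcov ha hb ha1 hb1 hE k i hB

/-- **THE COVERED-SET BRIDGE OF RECORD (fenced conjunction)**: on the covered set, `FourFrameLawsWildAtR2 omegaR N₀ tauOfRecord σ ϖ d t ↔ FourFrameLawsWildAtR N₀ tauOfRecord σ ϖ d t`
— U4 ∕ tier-0 consumers of the sign conjunct keep ★ №1-R's currency at the rows of record. [cite: LanglandsShelstad1987, §1.3] [cite: Rogawski1990, §4.9 Prop. 4.9.1 (a) p. 55] -/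
theorem fourFrameLawsWildAtR2_omegaR_iff_fourFrameLawsWildAtR_of_covered [CompleteSpace K] [Fintype 𝓀[K]] (N₀ : ℕ → ℕ) (σ : K →+* K) (ϖ : K) {d t : ℕ}
    (hcov : d % 2 = 1 ∨ 2 * d ≤ t + 2) :
    FourFrameLawsWildAtR2 omegaR N₀ tauOfRecord σ ϖ d t ↔ FourFrameLawsWildAtR N₀ tauOfRecord σ ϖ d t :=
  fourFrameLawsWildAtR2_iff_fourFrameLawsWildAtR_of_forall_eq_one_or_ampl_eq_zero omegaR N₀ tauOfRecord σ ϖ d t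
    fun _ _ _ _ _ _ k i _ hD _ _ ha hb ha1 hb1 hE _ hB => omegaR_eq_one_or_ampl_eq_zero_of_covered hD hcov ha hb ha1 hb1 hE k i hB

/-- **AT THE PARAMETERS OF RECORD** `(depthOfRecord, tauOfRecord)`, fenced: on the covered set,
`DyadicFence (KappaSignLawAtR2 omegaR depthOfRecord tauOfRecord σ ϖ d t) ↔ DyadicFence (KappaSignLawAtR depthOfRecord tauOfRecord σ ϖ d t)` — the spelling of U3's
`stub_U3_kappaSignLawR2` against the struck `stub_U3_kappaSignLawR`. [cite: LanglandsShelstad1987, §1.3] [cite: Rogawski1990, §4.9 Prop. 4.9.1 (a) p. 55] -/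
theorem dyadicFence_kappaSignLawAtR2_omegaR_iff_of_covered [CompleteSpace K] [Fintype 𝓀[K]] (σ : K →+* K) (ϖ : K) {d t : ℕ} (hcov : d % 2 = 1 ∨ 2 * d ≤ t + 2) :
    DyadicFence (K := K) (KappaSignLawAtR2 omegaR depthOfRecord tauOfRecord σ ϖ d t) ↔ DyadicFence (K := K) (KappaSignLawAtR depthOfRecord tauOfRecord σ ϖ d t) := by
  have h := kappaSignLawAtR2_omegaR_iff_kappaSignLawAtR_of_covered depthOfRecord σ ϖ hcov
  exact ⟨fun hR2 h2 => h.1 (hR2 h2), fun hR h2 => h.2 (hR h2)⟩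

end Summit.HodgeConjecture.HodgeConjecture.Cruxes.H413.F0P3cDyRamKappaSignLawR2OfRecord

end
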